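import Mathlib
import Summits.Ventures.PercRepro2.SwOutAll
import Summits.Ventures.PercRepro2.SwOutArmFlip
import Summits.Ventures.PercRepro2.SwOutArms
import Summits.Ventures.PercRepro2.SwOutArmOrbit
import Summits.Ventures.PercRepro2.SwOutArmCube
import Summits.Ventures.PercRepro2.SwOutArmThm
import Summits.Ventures.PercRepro2.SwOutJunctionFine
import Summits.Ventures.PercRepro2.SwOutJunctionRegion
import Summits.Ventures.PercRepro2.SwOutJunction
import Summits.Ventures.PercRepro2.SwOutJunctionsSplit
import Summits.Ventures.PercRepro2.SwOutJunctionsFine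
import Summits.Ventures.PercRepro2.SwOutJunctionsRegion
import Summits.Ventures.PercRepro2.SwOutJunctions
import Summits.Ventures.PercRepro2.SwOutAdjSplit
import Summits.Ventures.PercRepro2.SwOutAdjFine
import Summits.Ventures.PercRepro2.SwOutAdjRegion
import Summits.Ventures.PercRepro2.SwOutAdjMatched
import Summits.Ventures.PercRepro2.SwOutAdjCongr

/-!
# The blocks of a region with adjacent junctions (blind cell PercRepro2, night-4 g11,
2026-08-25; proofs/NIGHT4-G11.md §5(5))

For a `Q`-configuration `ζ₁` with matched set `M`, its **block** is the product cube
`arms ⊕ internal edges`: a block point `blockReal ω` is an orbit realisation of the base point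
(the all-red orientation, in the graph split at `M`, of `ζ₁` with its internal edges set to red)
with the internal edges recoloured by `ω`.  Every block point has the split hull of `ζ₁`, is
`M`-fine, lies in the class, and has matched set `M` (`aSet_blockReal`) — the block is the fibre of
`ζ ↦ (aSet ζ, blockBase ζ)` through `ζ₁`.
-/

namespace Summit.Ventures.PercRepro2

namespace LocRows

open Hull

variable {V : Type*} {E : Type*} [Fintype E] [DecidableEq E]

open scoped Classical

section BlockDefs

variable (ends : E → Sym2 V) (M : Set V) (h : V)

/-- The internal edges of `M` replaced by the values of `σ`. -/
noncomputable def setInt (η σ : Config E) : Config E := fun e => if Internal ends M e then σ e else η e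

/-- The internal edges of `M` set to red. -/
noncomputable def normRed (η : Config E) : Config E := setInt ends M η fun _ => true

/-- The base point of the block: the all-red orientation, in the graph split at `M`, of the
configuration with its internal edges set to red. -/
noncomputable def blockBase (ζ₁ : Config E) : Config E :=
  allRed (splitEndsS ends M) (normRed ends M ζ₁) (Sum.inl h)

/-- The index type of the block: the arms of the split graph at the base point, and the internal
edges. -/
abbrev BlockIdx (ζ₁ : Config E) : Type _ :=
  arms (splitEndsS ends M) (blockBase ends M h ζ₁) (Sum.inl h) ⊕ {e : E // Internal ends M e}

/-- A block point: the orbit realisation of the base point given by the arm part of `ω`, with the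
internal edges recoloured by the internal part of `ω`. -/
noncomputable def blockReal (ζ₁ : Config E) (ω : Config (BlockIdx ends M h ζ₁)) : Config E :=
  fun e => if hi : Internal ends M e then ω (Sum.inr ⟨e, hi⟩)
    else orbitReal (splitEndsS ends M) (blockBase ends M h ζ₁) (Sum.inl h) (ω ∘ Sum.inl) e

variable {ends M h}

omit [Fintype E] [DecidableEq E] in
/-- `setInt` takes the value of `σ` on an internal edge. -/
lemma setInt_of_internal {η σ : Config E} {e : E} (hi : Internal ends M e) :
    setInt ends M η σ e = σ e := by simp only [setInt, if_pos hi]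

omit [Fintype E] [DecidableEq E] in
/-- `setInt` keeps the value of `η` on a non-internal edge. -/
lemma setInt_of_not_internal {η σ : Config E} {e : E} (hi : ¬ Internal ends M e) :
    setInt ends M η σ e = η e := by simp only [setInt, if_neg hi]

omit [Fintype E] [DecidableEq E] in
/-- `normRed` is red on the internal edges. -/
lemma normRed_of_internal {η : Config E} {e : E} (hi : Internal ends M e) :
    normRed ends M η e = true := setInt_of_internal hi

omit [Fintype E] [DecidableEq E] in
/-- `normRed` keeps the non-internal edges. -/
lemma normRed_of_not_internal {η : Config E} {e : E} (hi : ¬ Internal ends M e) :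
    normRed ends M η e = η e := setInt_of_not_internal hi

omit [Fintype E] [DecidableEq E] in
/-- `normRed η` agrees with `η` off the internal edges. -/
lemma normRed_agree (η : Config E) : ∀ e, ¬ Internal ends M e → normRed ends M η e = η e :=
  fun _ hi => normRed_of_not_internal hi

omit [DecidableEq E] in
/-- A block point takes the internal part of `ω` on an internal edge. -/
lemma blockReal_of_internal {ζ₁ : Config E} (ω : Config (BlockIdx ends M h ζ₁)) {e : E}
    (hi : Internal ends M e) : blockReal ends M h ζ₁ ω e = ω (Sum.inr ⟨e, hi⟩) := by
  simp only [blockReal, dif_pos hi]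

omit [DecidableEq E] in
/-- A block point is the orbit realisation of its arm part on a non-internal edge. -/
lemma blockReal_of_not_internal {ζ₁ : Config E} (ω : Config (BlockIdx ends M h ζ₁)) {e : E}
    (hi : ¬ Internal ends M e) :
    blockReal ends M h ζ₁ ω e =
      orbitReal (splitEndsS ends M) (blockBase ends M h ζ₁) (Sum.inl h) (ω ∘ Sum.inl) e := by
  simp only [blockReal, dif_neg hi]

omit [DecidableEq E] in
/-- A block point agrees with its orbit realisation off the internal edges. -/
lemma blockReal_agree {ζ₁ : Config E} (ω : Config (BlockIdx ends M h ζ₁)) :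
    ∀ e, ¬ Internal ends M e → blockReal ends M h ζ₁ ω e =
      orbitReal (splitEndsS ends M) (blockBase ends M h ζ₁) (Sum.inl h) (ω ∘ Sum.inl) e :=
  fun _ hi => blockReal_of_not_internal ω hi

omit [Fintype E] [DecidableEq E] in
/-- The base point is red on the internal edges. -/
lemma blockBase_of_internal {ζ₁ : Config E} {e : E} (hi : Internal ends M e) :
    blockBase ends M h ζ₁ e = true := by
  unfold blockBase
  rw [allRed_splitS_apply_internal hi, normRed_of_internal hi]

omit [DecidableEq E] in
/-- `normRed` of a block point is its orbit realisation. -/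
lemma normRed_blockReal {ζ₁ : Config E} (ω : Config (BlockIdx ends M h ζ₁)) :
    normRed ends M (blockReal ends M h ζ₁ ω) =
      orbitReal (splitEndsS ends M) (blockBase ends M h ζ₁) (Sum.inl h) (ω ∘ Sum.inl) := by
  funext e
  by_cases hi : Internal ends M e
  · rw [normRed_of_internal hi, orbitReal_splitS_apply_internal _ hi, blockBase_of_internal hi]
  · rw [normRed_of_not_internal hi, blockReal_of_not_internal ω hi]

omit [DecidableEq E] in
/-- The block parametrisation is injective. -/
theorem blockReal_injective (ζ₁ : Config E) :
    Function.Injective (blockReal ends M h ζ₁) := by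
  intro ω ω' hωω'
  have h1 : orbitReal (splitEndsS ends M) (blockBase ends M h ζ₁) (Sum.inl h) (ω ∘ Sum.inl) =
      orbitReal (splitEndsS ends M) (blockBase ends M h ζ₁) (Sum.inl h) (ω' ∘ Sum.inl) := by
    rw [← normRed_blockReal ω, ← normRed_blockReal ω', hωω']
  have h2 : ω ∘ Sum.inl = ω' ∘ Sum.inl := orbitReal_injective h1
  funext i
  rcases i with P | e
  · exact congrFun h2 P
  · have := congrFun hωω' e.1
    rw [blockReal_of_internal ω e.2, blockReal_of_internal ω' e.2] at this
    exact this

end BlockDefs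

/-! ## The blocks of a region with junctions -/

section Block

variable {ends : E → Sym2 V} {U : Set V} {ξ : Config E} {l h o : V} {J : Set V}

variable (hl : l ∉ U) (hloop_h : ∀ e, ends e ≠ s(h, h)) (hJU : J ⊆ U) (hhJ : h ∉ J)
  (hadj : ∀ u ∈ J, ∀ e (he : u ∈ ends e), Sym2.Mem.other he ≠ h →
    ∃ e', ends e' = s(Sym2.Mem.other he, h))
  (hout : ∀ x ∈ U, x ≠ h → x ≠ o → x ∉ J →
    (∃ e y, ends e = s(x, y) ∧ y ∉ U) ∨ (∀ e, x ∉ ends e))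

include hhJ hadj hout in
/-- A `Q`-configuration is fine for its matched set. -/
theorem afine_aSet_of_mem {ζ : Config E} (hζ : ζ ∈ swOutSide ends l h o U ξ) :
    AFine ends (aSet ends J h ζ) h ζ :=
  afine_aSet hhJ hadj fun _ hx hx' => core_mem_J_of_out hout hζ hx hx'

include hhJ hout in
/-- A `Q`-configuration is core-free in the graph split at its matched set. -/
theorem coreFree_split_aSet_of_mem {ζ : Config E} (hζ : ζ ∈ swOutSide ends l h o U ξ) :
    CoreFree (splitEndsS ends (aSet ends J h ζ)) ζ (Sum.inl h) :=
  coreFree_split_aSet hhJ fun _ hx hx' => core_mem_J_of_out hout hζ hx hx'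

variable {ζ₁ : Config E} (hζ₁ : ζ₁ ∈ swOutSide ends l h o U ξ)

include hhJ hout hζ₁ in
/-- `normRed ζ₁` is core-free in the split graph. -/
lemma coreFree_normRed :
    CoreFree (splitEndsS ends (aSet ends J h ζ₁)) (normRed ends (aSet ends J h ζ₁) ζ₁)
      (Sum.inl h) :=
  coreFree_splitS_congr (fun e hi => (normRed_agree ζ₁ e hi).symm) _
    (coreFree_split_aSet_of_mem hhJ hout hζ₁)

include hhJ hout hζ₁ in
/-- The base point is core-free in the split graph. -/
lemma coreFree_blockBase :
    CoreFree (splitEndsS ends (aSet ends J h ζ₁)) (blockBase ends (aSet ends J h ζ₁) h ζ₁)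
      (Sum.inl h) :=
  coreFree_allRed (coreFree_normRed hhJ hout hζ₁)

include hhJ hout hζ₁ in
/-- Every block point has the split hull of `ζ₁`. -/
theorem hull_blockReal (ω : Config (BlockIdx ends (aSet ends J h ζ₁) h ζ₁)) :
    hull (splitEndsS ends (aSet ends J h ζ₁)) (blockReal ends (aSet ends J h ζ₁) h ζ₁ ω)
        (Sum.inl h) =
      hull (splitEndsS ends (aSet ends J h ζ₁)) ζ₁ (Sum.inl h) := by
  rw [hull_splitS_congr (blockReal_agree ω), hull_orbitReal (coreFree_blockBase hhJ hout hζ₁),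
    blockBase, hull_allRed (coreFree_normRed hhJ hout hζ₁),
    hull_splitS_congr (normRed_agree ζ₁)]

include hhJ hadj hout hζ₁ in
/-- Every block point is fine for the matched set of `ζ₁`. -/
theorem afine_blockReal (ω : Config (BlockIdx ends (aSet ends J h ζ₁) h ζ₁)) :
    AFine ends (aSet ends J h ζ₁) h (blockReal ends (aSet ends J h ζ₁) h ζ₁ ω) := by
  intro e he hi
  rw [hull_blockReal hhJ hout hζ₁]
  exact afine_aSet_of_mem hhJ hadj hout hζ₁ e he hi

include hhJ hout hζ₁ in
/-- Every block point is core-free in the split graph. -/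
theorem coreFree_blockReal (ω : Config (BlockIdx ends (aSet ends J h ζ₁) h ζ₁)) :
    CoreFree (splitEndsS ends (aSet ends J h ζ₁)) (blockReal ends (aSet ends J h ζ₁) h ζ₁ ω)
      (Sum.inl h) :=
  coreFree_splitS_congr (fun e hi => (blockReal_agree ω e hi).symm) _
    (coreFree_orbitReal (coreFree_blockBase hhJ hout hζ₁) _)

include hhJ hadj hout hζ₁ in
/-- **The matched set is constant on the block.** -/
theorem aSet_blockReal (ω : Config (BlockIdx ends (aSet ends J h ζ₁) h ζ₁)) :
    aSet ends J h (blockReal ends (aSet ends J h ζ₁) h ζ₁ ω) = aSet ends J h ζ₁ := by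
  have hhM : h ∉ aSet ends J h ζ₁ := fun h' => hhJ (aSet_subset h')
  have hfη : AFine ends (aSet ends J h ζ₁) h (blockReal ends (aSet ends J h ζ₁) h ζ₁ ω) :=
    afine_blockReal hhJ hadj hout hζ₁ ω
  have hf₁ : AFine ends (aSet ends J h ζ₁) h ζ₁ := afine_aSet_of_mem hhJ hadj hout hζ₁
  have hc₁ := coreFree_normRed hhJ hout hζ₁
  have hc₀ := coreFree_blockBase hhJ hout hζ₁
  -- the matched set of `ζ₁` is good for the block point
  have hMη : aSet ends J h ζ₁ ⊆ aSet ends J h (blockReal ends (aSet ends J h ζ₁) h ζ₁ ω) :=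
    subset_aSet_of_good ⟨aSet_subset, fun _ hu _ hue hi => edgeMatched_of_afine hfη hu hue hi⟩
  apply Set.Subset.antisymm _ hMη
  -- the matched set of the block point is good for `ζ₁`
  refine subset_aSet_of_good ⟨aSet_subset, ?_⟩
  intro u hu e hue hi
  have hmη : EdgeMatched ends h (blockReal ends (aSet ends J h ζ₁) h ζ₁ ω) e :=
    edgeMatched_of_mem_aSet hu hue hi
  by_cases hM' : ∃ w ∈ aSet ends J h ζ₁, w ∈ ends e
  · obtain ⟨w, hwM, hwe⟩ := hM'
    have hiM : ¬ Internal ends (aSet ends J h ζ₁) e := fun hi' => hi (hi'.mono hMη)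
    exact edgeMatched_of_mem_aSet (η := ζ₁) hwM hwe hiM
  · push Not at hM'
    have he : ∀ z ∈ ends e, z ∉ aSet ends J h ζ₁ := fun z hz hzM => hM' z hzM hz
    have hiM : ¬ Internal ends (aSet ends J h ζ₁) e := fun hi' => hM' u (hi' u hue) hue
    rw [← edgeMatched_splitS_iff hhM hf₁ he]
    rw [← edgeMatched_splitS_iff hhM hfη he] at hmη
    -- transfer along the two arm flips back to `normRed ζ₁`, then to `ζ₁`
    have h1 : EdgeMatched (splitEndsS ends (aSet ends J h ζ₁)) (Sum.inl h)
        (orbitReal (splitEndsS ends (aSet ends J h ζ₁)) (blockBase ends (aSet ends J h ζ₁) h ζ₁)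
          (Sum.inl h) (ω ∘ Sum.inl)) e := by
      obtain ⟨hm1, hm2⟩ := hmη
      rw [cluster_splitS_congr (blockReal_agree ω)] at hm1
      rw [cluster_blue_splitS_congr (blockReal_agree ω)] at hm2
      rw [blockReal_agree ω e hiM] at hm1 hm2
      exact ⟨hm1, hm2⟩
    have h2 := edgeMatched_of_edgeMatched_flip (coreFree_allRed hc₀)
      (armClosed_armsFalse_allRed hc₀ (ω ∘ Sum.inl)) h1
    rw [blockBase, allRed_idem hc₁] at h2
    have h3 := edgeMatched_of_edgeMatched_flip hc₁ (armClosed_blueSide hc₁) h2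
    obtain ⟨hm1, hm2⟩ := h3
    rw [cluster_splitS_congr (normRed_agree ζ₁)] at hm1
    rw [cluster_blue_splitS_congr (normRed_agree ζ₁)] at hm2
    rw [normRed_agree ζ₁ e hiM] at hm1 hm2
    exact ⟨hm1, hm2⟩

include hJU hhJ hout hζ₁ in
/-- The base point lies in the class of the split graph. -/
lemma blockBase_mem_outClass :
    blockBase ends (aSet ends J h ζ₁) h ζ₁ ∈
      outClass (splitEndsS ends (aSet ends J h ζ₁)) (splitRegionS U) (Sum.inl h) ξ := by
  have hMU : aSet ends J h ζ₁ ⊆ U := fun u hu => hJU (aSet_subset hu)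
  have hcl₁ := mem_outClass_splitS_of_mem' (h := h) hMU (mem_swOutSide.1 hζ₁).2
  have hcln := mem_outClass_splitS_congr (fun e hi => (normRed_agree ζ₁ e hi).symm) hcl₁
  exact allRed_mem_outClass hcln (coreFree_normRed hhJ hout hζ₁)

include hJU hhJ hadj hout hζ₁ in
/-- Every block point lies in the class. -/
theorem blockReal_mem_outClass (ω : Config (BlockIdx ends (aSet ends J h ζ₁) h ζ₁)) :
    blockReal ends (aSet ends J h ζ₁) h ζ₁ ω ∈ outClass ends U h ξ := by
  have hMU : aSet ends J h ζ₁ ⊆ U := fun u hu => hJU (aSet_subset hu)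
  have hhM : h ∉ aSet ends J h ζ₁ := fun h' => hhJ (aSet_subset h')
  refine mem_outClass_of_mem_splitS' hMU hhM (afine_blockReal hhJ hadj hout hζ₁ ω) ?_
  refine mem_outClass_splitS_congr (fun e hi => (blockReal_agree ω e hi).symm) ?_
  exact orbitReal_mem_outClass (coreFree_blockBase hhJ hout hζ₁)
    (blockBase_mem_outClass hJU hhJ hout hζ₁) _

end Block

end LocRows

end Summit.Ventures.PercRepro2
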